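import Literature.AlgebraicGeometry.Modules.PushforwardBaseChangeOpenImmersion
import Literature.AlgebraicGeometry.Modules.PushforwardBaseChangeCharts
import HarnessLib

/-!
# The base-change morphism on ONE chart, the «∀ F, bijective» currency, and the affine-base edition

[Hartshorne1977] III Prop. 9.3 (proof) / [StacksProject, Tag 02KG–02KH]: the base change map `β : b^*(p_* G) ⟶ p_{T*}(pr^* G)` is
an isomorphism as soon as, on every affine `W` of the new base lying over an affine `V` of the old one,
`Γ(W) ⊗_{Γ(V)} Γ(p⁻¹V, G) ⟶ Γ(X_W, pr^*G)`, `t ⊗ s ↦ t · η_{pr}(s)|`, is bijective.  ★ `Modules/PushforwardBaseChangeCharts`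
(FILE D) packaged this for ALL affine `V ⊆ S`; THIS FILE adds the pieces the cell's (h2) «cohomology and base change» files
plug into (their statements live over an AFFINE base `S = Spec A`, i.e. at `V = ⊤`):

* §1 (S1) **`bijective_unitSectionLE_ι`** — for `U ⊆ X` open and any `𝒪_X`-module `M`, `m ↦ η_{U.ι}(m)|_⊤ : Γ(M, U) → Γ(U.ι^*M, ⊤)`
  is BIJECTIVE (the sections of the restriction `M|_U` over all of `U`; Mathlib `restrictFunctorIsoPullback` through ★ (L1)
  `restrictFunctorIsoPullback_hom_app_eq`), with the value formula `unitSectionLE_ι_eq_restrictFunctorIsoPullback`;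
* §2 (S2) per chart: **`pushforwardBaseChangeHom_app_bijective_of_chart`** (FILE D's inner block: an `e` with the pure-tensor
  formula on the chart `(V, W)` ⇒ `β_W` bijective) and **`pushforwardBaseChangeHom_app_bijective_of_forall_bijective`** (the same
  from the weaker «every `Γ(T, W)`-linear `F : Γ(W) ⊗_{Γ(V)} Γ(p_*G, V) → Γ(pT_*(pr^*G), W)` with the formula is bijective», which
  is the currency ★ `Morphisms/SectionsBaseChangeOfFibrewiseVanishing.exists_tensor_secMod_top_linearEquiv_of_forall_prime` exports);
* §3 the AFFINE-BASE edition: **`isIso_pushforwardBaseChangeHom_of_charts_top`** / **`…_of_forall_bijective_top`** — for `S` affine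
  it suffices to know the charts `(⊤, W)`, `W ⊆ T` affine (affine opens are a basis of `T`).

Theorems only; no `sorry`, no instance, no named fact.  Cell hodgecm-mathlib, F-DAG (h2)/(h6-d) split with B-p19 (g15) (G9, 06:18Z):
(S1)+(S2) here, G9 = the affine-base chart theorem over ★ G8, (S3) = Zariski-localisation on `S`.  HC_CM is proved only modulo
the printed citations until rung 0 closes; this file discharges none of them.

## References
* [Hartshorne1977] R. Hartshorne, *Algebraic Geometry* (1977), III Prop. 9.3 (proof), II §5 p. 110.
* [StacksProject] The Stacks Project, Tag 02KG (affine base change), Tag 02KH (flat base change), Tag 02N6 (base change map).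
-/

noncomputable section

-- `TopCat.Presheaf`/`Scheme.Modules` are not reducible (as in Mathlib's `AlgebraicGeometry/Modules/Sheaf.lean`).
set_option backward.isDefEq.respectTransparency false

open CategoryTheory CategoryTheory.Limits AlgebraicGeometry TopologicalSpace Opposite TensorProduct

universe u

namespace Literature.AlgebraicGeometry.Modules

/-! ### §1 Sections of `U.ι^* M` over `⊤` are the sections of `M` over `U` -/

section Iota

variable {X : Scheme.{u}} (M : X.Modules) (U : X.Opens)

/-- The pulled-back section `η_{U.ι}(m)|_⊤` IS the image under Mathlib's `restrictFunctorIsoPullback U.ι` of `m` read as a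
section of `M|_U` over `⊤` (i.e. of `M` over `U.ι(⊤) = U`). [cite: Hartshorne1977, II §5 p. 110] -/
theorem unitSectionLE_ι_eq_restrictFunctorIsoPullback (i : (⊤ : (U : Scheme.{u}).Opens) ≤ U.ι ⁻¹ᵁ U) (m : Γ(M, U)) :
    unitSectionLE U.ι M i m =
      ((Scheme.Modules.restrictFunctorIsoPullback U.ι).hom.app M).app ⊤
        (show Γ(M.restrict U.ι, ⊤) from M.presheaf.map (eqToHom U.ι_image_top).op m) := by
  rw [restrictFunctorIsoPullback_hom_app_eq]
  simp only [unitSectionLE]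
  -- `η(m|_{ι(⊤)}) = η(m)|` by naturality of the unit in the open
  have h := unitSection_map U.ι M (eqToHom U.ι_image_top : U.ι ''ᵁ ⊤ ⟶ U) m
  change ((Scheme.Modules.pullback U.ι).obj M).presheaf.map (homOfLE i).op (unitSection U.ι M U m) =
    ((Scheme.Modules.pullback U.ι).obj M).presheaf.map _ (unitSection U.ι M (U.ι ''ᵁ ⊤) (M.presheaf.map _ m))
  rw [h, ← CategoryTheory.comp_apply, ← Functor.map_comp]
  exact presheaf_map_congr _ _ _ _

/-- **(S1) `m ↦ η_{U.ι}(m)|_⊤ : Γ(M, U) → Γ(U.ι^* M, ⊤)` is bijective** — the global sections of the restriction of `M` to the open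
subscheme `U` are the sections of `M` over `U` (Mathlib `restrictFunctorIsoPullback`, `restrictAppIso`, `Opens.ι_image_top`).
[cite: Hartshorne1977, II §5 p. 110] [cite: StacksProject, Tag 02KG] -/
theorem bijective_unitSectionLE_ι (i : (⊤ : (U : Scheme.{u}).Opens) ≤ U.ι ⁻¹ᵁ U) :
    Function.Bijective (unitSectionLE U.ι M (V := U) (U := ⊤) i) := by
  have h1 : Function.Bijective (((Scheme.Modules.restrictFunctorIsoPullback U.ι).hom.app M).app ⊤) :=
    ConcreteCategory.bijective_of_isIso _
  have h2 : Function.Bijective (M.presheaf.map (eqToHom U.ι_image_top).op) :=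
    ConcreteCategory.bijective_of_isIso _
  have e : (unitSectionLE U.ι M (V := U) (U := ⊤) i) =
      (((Scheme.Modules.restrictFunctorIsoPullback U.ι).hom.app M).app ⊤) ∘
        (fun m : Γ(M, U) => (show Γ(M.restrict U.ι, ⊤) from M.presheaf.map (eqToHom U.ι_image_top).op m)) := by
    funext m
    exact unitSectionLE_ι_eq_restrictFunctorIsoPullback M U i m
  rw [e]
  exact h1.comp h2

end Iota

/-! ### §2 One chart: `β_W` is bijective -/

section Chart

variable {X S T XT : Scheme.{u}} {pr : XT ⟶ X} {pT : XT ⟶ T} {p : X ⟶ S} {b : T ⟶ S} (w : pr ≫ p = pT ≫ b)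
  (G : X.Modules)

/-- **(S2, «∀ F» form) On a chart `(V, W)` — `V ⊆ S`, `W ⊆ b⁻¹V` affine, `p_*G` affine-localizing — `β_W` is bijective as soon as
EVERY `Γ(T, W)`-linear map `F : Γ(T, W) ⊗_{Γ(S, V)} Γ(p_*G, V) → Γ(pT_*(pr^*G), W)` with `F (t ⊗ s) = t · η_{pr}(s)|_{pT⁻¹W}` is
bijective** (apply it to `β_W ∘ (Γ(W) ⊗ Γ(p_*G, V) ≃ Γ(W, b^* p_* G))`, ★ `isBaseChange_unitSectionLE`).  This is the currency ★
`SectionsBaseChangeOfFibrewiseVanishing.exists_tensor_secMod_top_linearEquiv_of_forall_prime` exports.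
[cite: Hartshorne1977, III Prop. 9.3 (proof)] [cite: StacksProject, Tag 02KG] -/
theorem pushforwardBaseChangeHom_app_bijective_of_forall_bijective
    (hN : IsAffineLocalizing ((Scheme.Modules.pushforward p).obj G))
    {V : S.Opens} (hV : IsAffineOpen V) {W : T.Opens} (hW : IsAffineOpen W) (i : W ≤ b ⁻¹ᵁ V)
    (h : letI := (b.appLE V W i).hom.toAlgebra
      ∀ F : Γ(T, W) ⊗[Γ(S, V)] Γ((Scheme.Modules.pushforward p).obj G, V) →ₗ[Γ(T, W)]
          Γ((Scheme.Modules.pushforward pT).obj ((Scheme.Modules.pullback pr).obj G), W),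
        (∀ (t : Γ(T, W)) (s : Γ(G, p ⁻¹ᵁ V)),
          F (t ⊗ₜ (show Γ((Scheme.Modules.pushforward p).obj G, V) from s)) =
            t • (show Γ((Scheme.Modules.pushforward pT).obj ((Scheme.Modules.pullback pr).obj G), W) from
              unitSectionLE pr G ((Scheme.Hom.preimage_mono pT i).trans (preimage_preimage_eq_of_sq w V).ge) s)) →
        Function.Bijective F) :
    Function.Bijective ((pushforwardBaseChangeHom w G).app W) := by
  letI := (b.appLE V W i).hom.toAlgebra
  letI : Module Γ(S, V) Γ((Scheme.Modules.pullback b).obj ((Scheme.Modules.pushforward p).obj G), W) :=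
    Module.compHom _ (b.appLE V W i).hom
  haveI : IsScalarTower Γ(S, V) Γ(T, W)
      Γ((Scheme.Modules.pullback b).obj ((Scheme.Modules.pushforward p).obj G), W) :=
    ⟨fun a c x => mul_smul ((b.appLE V W i).hom a) c x⟩
  have hbc := isBaseChange_unitSectionLE (f := b) (M := (Scheme.Modules.pushforward p).obj G) (i := i) hV hW hN
  let βl : Γ((Scheme.Modules.pullback b).obj ((Scheme.Modules.pushforward p).obj G), W) →ₗ[Γ(T, W)]
      Γ((Scheme.Modules.pushforward pT).obj ((Scheme.Modules.pullback pr).obj G), W) :=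
    { toFun := (pushforwardBaseChangeHom w G).app W
      map_add' := fun x y => map_add _ x y
      map_smul' := fun t x => Scheme.Modules.Hom.app_smul _ t x }
  have hF : Function.Bijective (βl ∘ₗ hbc.equiv.toLinearMap) := by
    refine h _ fun t s => ?_
    change βl (hbc.equiv (t ⊗ₜ _)) = _
    rw [IsBaseChange.equiv_tmul]
    exact pushforwardBaseChangeHom_app_smul_unitSectionLE w G i t s
  have hcomp : ((βl ∘ₗ hbc.equiv.toLinearMap : _ →ₗ[Γ(T, W)] _) : _ → _) = βl ∘ hbc.equiv := rfl
  rw [hcomp] at hF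
  exact (Function.Bijective.of_comp_iff _ hbc.equiv.bijective).mp hF

/-- **(S2, `∃ e` form) On a chart `(V, W)`, an isomorphism `e : Γ(T, W) ⊗_{Γ(S, V)} Γ(p_*G, V) ≃ Γ(pT_*(pr^*G), W)` with the
pure-tensor formula makes `β_W` bijective** (★ FILE D's inner block, exposed per chart: `β_W ∘ hbc.equiv = e` on pure tensors,
`TensorProduct.AlgebraTensorModule.ext`). [cite: Hartshorne1977, III Prop. 9.3 (proof)] [cite: StacksProject, Tag 02KH] -/
theorem pushforwardBaseChangeHom_app_bijective_of_chart
    (hN : IsAffineLocalizing ((Scheme.Modules.pushforward p).obj G))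
    {V : S.Opens} (hV : IsAffineOpen V) {W : T.Opens} (hW : IsAffineOpen W) (i : W ≤ b ⁻¹ᵁ V)
    (h : letI := (b.appLE V W i).hom.toAlgebra
      ∃ e : Γ(T, W) ⊗[Γ(S, V)] Γ((Scheme.Modules.pushforward p).obj G, V) ≃ₗ[Γ(T, W)]
          Γ((Scheme.Modules.pushforward pT).obj ((Scheme.Modules.pullback pr).obj G), W),
        ∀ (t : Γ(T, W)) (s : Γ(G, p ⁻¹ᵁ V)),
          e (t ⊗ₜ (show Γ((Scheme.Modules.pushforward p).obj G, V) from s)) =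
            t • (show Γ((Scheme.Modules.pushforward pT).obj ((Scheme.Modules.pullback pr).obj G), W) from
              unitSectionLE pr G ((Scheme.Hom.preimage_mono pT i).trans (preimage_preimage_eq_of_sq w V).ge) s)) :
    Function.Bijective ((pushforwardBaseChangeHom w G).app W) := by
  refine pushforwardBaseChangeHom_app_bijective_of_forall_bijective w G hN hV hW i fun F hF => ?_
  letI := (b.appLE V W i).hom.toAlgebra
  letI : Module Γ(S, V) Γ((Scheme.Modules.pushforward pT).obj ((Scheme.Modules.pullback pr).obj G), W) :=
    Module.compHom _ (b.appLE V W i).hom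
  haveI : IsScalarTower Γ(S, V) Γ(T, W)
      Γ((Scheme.Modules.pushforward pT).obj ((Scheme.Modules.pullback pr).obj G), W) :=
    ⟨fun a c x => mul_smul ((b.appLE V W i).hom a) c x⟩
  obtain ⟨e, he⟩ := h
  have key : F = e.toLinearMap := by
    apply TensorProduct.AlgebraTensorModule.ext
    intro t s
    rw [hF t s]
    exact (he t s).symm
  rw [key]
  exact e.bijective

end Chart

/-! ### §3 Affine base: the charts `(⊤, W)` suffice -/

section Top

variable {X S T XT : Scheme.{u}} {pr : XT ⟶ X} {pT : XT ⟶ T} {p : X ⟶ S} {b : T ⟶ S} (w : pr ≫ p = pT ≫ b)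
  (G : X.Modules)

/-- **(S2) Affine base, «∀ F» form**: for `S` affine and `p_*G` affine-localizing, if on every affine `W ⊆ T` every
`Γ(T, W)`-linear `F : Γ(T, W) ⊗_{Γ(S, ⊤)} Γ(p_*G, ⊤) → Γ(pT_*(pr^*G), W)` with `F (t ⊗ s) = t · η_{pr}(s)|_{pT⁻¹W}` is bijective, then
`β = pushforwardBaseChangeHom w G` is an ISOMORPHISM (affine opens are a basis of `T`; §2).
[cite: Hartshorne1977, III Prop. 9.3 (proof)] [cite: StacksProject, Tag 02KH] -/
theorem isIso_pushforwardBaseChangeHom_of_forall_bijective_top [IsAffine S]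
    (hN : IsAffineLocalizing ((Scheme.Modules.pushforward p).obj G))
    (h : ∀ (W : T.Opens) (_ : IsAffineOpen W),
      letI := (b.appLE ⊤ W le_top).hom.toAlgebra
      ∀ F : Γ(T, W) ⊗[Γ(S, ⊤)] Γ((Scheme.Modules.pushforward p).obj G, ⊤) →ₗ[Γ(T, W)]
          Γ((Scheme.Modules.pushforward pT).obj ((Scheme.Modules.pullback pr).obj G), W),
        (∀ (t : Γ(T, W)) (s : Γ(G, p ⁻¹ᵁ ⊤)),
          F (t ⊗ₜ (show Γ((Scheme.Modules.pushforward p).obj G, ⊤) from s)) =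
            t • (show Γ((Scheme.Modules.pushforward pT).obj ((Scheme.Modules.pullback pr).obj G), W) from
              unitSectionLE pr G ((Scheme.Hom.preimage_mono pT (le_top : W ≤ b ⁻¹ᵁ ⊤)).trans
                (preimage_preimage_eq_of_sq w ⊤).ge) s)) →
        Function.Bijective F) :
    IsIso (pushforwardBaseChangeHom w G) :=
  isIso_of_bijective_app_of_isAffineOpen _ fun W hW =>
    pushforwardBaseChangeHom_app_bijective_of_forall_bijective w G hN (isAffineOpen_top S) hW le_top (h W hW)

/-- **(S2) Affine base, `∃ e` form**: for `S` affine and `p_*G` affine-localizing, isomorphisms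
`Γ(T, W) ⊗_{Γ(S, ⊤)} Γ(p_*G, ⊤) ≃ Γ(pT_*(pr^*G), W)` with the pure-tensor formula on all affine `W ⊆ T` make `β` an isomorphism.
[cite: Hartshorne1977, III Prop. 9.3 (proof)] [cite: StacksProject, Tag 02KH] -/
theorem isIso_pushforwardBaseChangeHom_of_charts_top [IsAffine S]
    (hN : IsAffineLocalizing ((Scheme.Modules.pushforward p).obj G))
    (h : ∀ (W : T.Opens) (_ : IsAffineOpen W),
      letI := (b.appLE ⊤ W le_top).hom.toAlgebra
      ∃ e : Γ(T, W) ⊗[Γ(S, ⊤)] Γ((Scheme.Modules.pushforward p).obj G, ⊤) ≃ₗ[Γ(T, W)]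
          Γ((Scheme.Modules.pushforward pT).obj ((Scheme.Modules.pullback pr).obj G), W),
        ∀ (t : Γ(T, W)) (s : Γ(G, p ⁻¹ᵁ ⊤)),
          e (t ⊗ₜ (show Γ((Scheme.Modules.pushforward p).obj G, ⊤) from s)) =
            t • (show Γ((Scheme.Modules.pushforward pT).obj ((Scheme.Modules.pullback pr).obj G), W) from
              unitSectionLE pr G ((Scheme.Hom.preimage_mono pT (le_top : W ≤ b ⁻¹ᵁ ⊤)).trans
                (preimage_preimage_eq_of_sq w ⊤).ge) s)) :
    IsIso (pushforwardBaseChangeHom w G) :=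
  isIso_of_bijective_app_of_isAffineOpen _ fun W hW =>
    pushforwardBaseChangeHom_app_bijective_of_chart w G hN (isAffineOpen_top S) hW le_top (h W hW)

/-- **Mono, affine base, «∀ F injective» form**: for `S` affine, injectivity of every `Γ(T, W)`-linear map with the pure-tensor
formula on every affine `W ⊆ T` makes `β` a monomorphism (the (hbc) input of ★ `Morphisms/ContainmentRepOfPushforward`).
[cite: StacksProject, Tag 02KG] -/
theorem mono_pushforwardBaseChangeHom_of_forall_injective_top [IsAffine S]
    (hN : IsAffineLocalizing ((Scheme.Modules.pushforward p).obj G))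
    (h : ∀ (W : T.Opens) (_ : IsAffineOpen W),
      letI := (b.appLE ⊤ W le_top).hom.toAlgebra
      ∀ F : Γ(T, W) ⊗[Γ(S, ⊤)] Γ((Scheme.Modules.pushforward p).obj G, ⊤) →ₗ[Γ(T, W)]
          Γ((Scheme.Modules.pushforward pT).obj ((Scheme.Modules.pullback pr).obj G), W),
        (∀ (t : Γ(T, W)) (s : Γ(G, p ⁻¹ᵁ ⊤)),
          F (t ⊗ₜ (show Γ((Scheme.Modules.pushforward p).obj G, ⊤) from s)) =
            t • (show Γ((Scheme.Modules.pushforward pT).obj ((Scheme.Modules.pullback pr).obj G), W) from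
              unitSectionLE pr G ((Scheme.Hom.preimage_mono pT (le_top : W ≤ b ⁻¹ᵁ ⊤)).trans
                (preimage_preimage_eq_of_sq w ⊤).ge) s)) →
        Function.Injective F) :
    Mono (pushforwardBaseChangeHom w G) := by
  refine mono_of_injective_app_of_isAffineOpen _ fun W hW => ?_
  letI := (b.appLE ⊤ W le_top).hom.toAlgebra
  letI : Module Γ(S, ⊤) Γ((Scheme.Modules.pullback b).obj ((Scheme.Modules.pushforward p).obj G), W) :=
    Module.compHom _ (b.appLE ⊤ W le_top).hom
  haveI : IsScalarTower Γ(S, ⊤) Γ(T, W)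
      Γ((Scheme.Modules.pullback b).obj ((Scheme.Modules.pushforward p).obj G), W) :=
    ⟨fun a c x => mul_smul ((b.appLE ⊤ W le_top).hom a) c x⟩
  have hbc := isBaseChange_unitSectionLE (f := b) (M := (Scheme.Modules.pushforward p).obj G) (i := le_top)
    (isAffineOpen_top S) hW hN
  let βl : Γ((Scheme.Modules.pullback b).obj ((Scheme.Modules.pushforward p).obj G), W) →ₗ[Γ(T, W)]
      Γ((Scheme.Modules.pushforward pT).obj ((Scheme.Modules.pullback pr).obj G), W) :=
    { toFun := (pushforwardBaseChangeHom w G).app W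
      map_add' := fun x y => map_add _ x y
      map_smul' := fun t x => Scheme.Modules.Hom.app_smul _ t x }
  have hF : Function.Injective (βl ∘ₗ hbc.equiv.toLinearMap) := by
    refine h W hW _ fun t s => ?_
    change βl (hbc.equiv (t ⊗ₜ _)) = _
    rw [IsBaseChange.equiv_tmul]
    exact pushforwardBaseChangeHom_app_smul_unitSectionLE w G le_top t s
  have hcomp : ((βl ∘ₗ hbc.equiv.toLinearMap : _ →ₗ[Γ(T, W)] _) : _ → _) = βl ∘ hbc.equiv := rfl
  rw [hcomp] at hF
  exact (Function.Injective.of_comp_iff' _ hbc.equiv.bijective).mp hF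

end Top

end Literature.AlgebraicGeometry.Modules

end
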